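import Literature.NumberTheory.GaloisRepresentations.NearlyOrdinaryPresentationProofs
import HarnessLib

/-!
# Route `ParityBlindBianchi`, crux `TwoAdicBianchiProModularityLevel` (stmt-Langlands-15110), line
# `dimension-squeeze`: the unframing transfer lemma (GAL v3, wave 3)

Pure commutative algebra used by the Galois half (GAL) of the squeeze.  Kisin-style presentations
control the FRAMED typed deformation ring `R^{θ,□}`; since the residual representation is absolutely
irreducible, `R^{θ,□} ≅ R^θ⟦y₁, …, y_m⟧` (`m = 4|S| − 1` framing variables), and the two conclusions GAL
needs for the UNFRAMED ring `R^θ` — "integral domain" and "Krull dimension `≤ 4`" — descend: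

* `isDomain_of_ringEquiv_mvPowerSeries` — if `B ≃+* Q⟦y₁, …, y_m⟧` and `B` is a domain, so is `Q`
  (`Q ↪ Q⟦y⟧` by constants);
* `ringKrullDim_le_of_ringEquiv_mvPowerSeries` — if moreover `dim B ≤ d + m` then `dim Q ≤ d`
  (`dim Q + m ≤ dim Q⟦y₁, …, y_m⟧`, tree
  `NearlyOrdinaryPresentationCA.ringKrullDim_add_le_ringKrullDim_mvPowerSeries`, valid for every
  commutative ring — no Noetherian hypothesis is needed in this direction);
* `squeeze_unframing_transfer` — the packaged form `IsDomain Q ∧ ringKrullDim Q ≤ 4` from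
  `IsDomain B ∧ ringKrullDim B ≤ 4 + m`.

References: H. Matsumura, *Commutative ring theory*, CUP 1986, Thm. 15.4 [cite: Matsumura1987, Thm. 15.4];
M. Kisin, *Moduli of finite flat group schemes, and modularity*, Ann. of Math. 170 (2009), (2.3.9)–(3.4.12)
(framed vs. unframed deformation rings) [cite: KisinModuli2009, §2.3].
-/

set_option linter.dupNamespace false -- `Summit.Langlands.Langlands` is the mandated namespace (D-0017)

namespace Summit.Langlands.Langlands.Cruxes.TwoAdicBianchiProModularityLevel.DimensionSqueeze

open Literature.NumberTheory.GaloisRepresentations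

universe u v

variable {Q : Type u} {B : Type v} [CommRing Q] [CommRing B] {m : ℕ}

/-- **Domains descend along unframing**: if `B ≃+* Q⟦y₁, …, y_m⟧` and `B` is an integral domain then so
is `Q` (the constants `C : Q → Q⟦y⟧` are injective). [folklore] -/
theorem isDomain_of_ringEquiv_mvPowerSeries (e : B ≃+* MvPowerSeries (Fin m) Q) [IsDomain B] :
    IsDomain Q :=
  haveI : IsDomain (MvPowerSeries (Fin m) Q) := e.symm.injective.isDomain e.symm.toRingHom
  (MvPowerSeries.C_injective (σ := Fin m) (R := Q)).isDomain (MvPowerSeries.C (σ := Fin m) (R := Q))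

/-- **Dimension bounds descend along unframing**: if `B ≃+* Q⟦y₁, …, y_m⟧` and `dim B ≤ d + m` then
`dim Q ≤ d`, because `dim Q + m ≤ dim Q⟦y₁, …, y_m⟧` for every commutative ring `Q`.
[cite: Matsumura1987, Thm. 15.4] -/
theorem ringKrullDim_le_of_ringEquiv_mvPowerSeries (e : B ≃+* MvPowerSeries (Fin m) Q) {d : ℕ}
    (hdim : ringKrullDim B ≤ (d : WithBot ℕ∞) + m) : ringKrullDim Q ≤ d := by
  have h := NearlyOrdinaryPresentationCA.ringKrullDim_add_le_ringKrullDim_mvPowerSeries Q m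
  rw [← ringKrullDim_eq_of_ringEquiv e] at h
  exact ENat.WithBot.add_le_add_natCast_right_iff.mp (h.trans hdim)

/-- REGISTERED SUB-GOAL `squeeze_unframing_transfer` — **the unframing transfer lemma** (the form GAL
consumes, `d = 4`): if `B ≃+* Q⟦y₁, …, y_m⟧` with `B` an integral domain of Krull dimension `≤ 4 + m`,
then `Q` is an integral domain of Krull dimension `≤ 4`. [cite: Matsumura1987, Thm. 15.4] -/
theorem squeeze_unframing_transfer : ∀ (Q B : Type) [CommRing Q] [CommRing B] (m : ℕ), (B ≃+* MvPowerSeries (Fin m) Q) → IsDomain B → ringKrullDim B ≤ 4 + m → IsDomain Q ∧ ringKrullDim Q ≤ 4 :=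
  fun _ _ _ _ _ e _ hdim =>
    ⟨isDomain_of_ringEquiv_mvPowerSeries e,
      by exact_mod_cast ringKrullDim_le_of_ringEquiv_mvPowerSeries e (d := 4) (by exact_mod_cast hdim)⟩

end Summit.Langlands.Langlands.Cruxes.TwoAdicBianchiProModularityLevel.DimensionSqueeze
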